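import Summits.QuantumFields.YangMills.Theorems.QuantileBitPuritySectorDefs
import Summits.QuantumFields.YangMills.Theorems.QuantileBitRingChain
import Summits.QuantumFields.YangMills.Theorems.LuscherReductionTwistedTraceScalingAllLinks
import HarnessLib

/-!
# The eight seam sectors of the zero-flux thermal ring: decomposition of slice weights and the PERIODIC-SECTOR DOOR

Support module (`--supports` stmt-QuantumFields-23948, `QuantileBitPurity.HolonomyQuantileSubQuartic`, LINE g12-B of seat ym-idea-4; memo HOME
`bc/g14-dw/SECTORS-translates.md`).  The ring trace `TT.ringInsTrace L β n 𝟙_A 0` (the un-normalised thermal weight of a slice event at temperature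
`1/(n+1)`) closes through `physAvg = (1/8) Σ_z ∫ dg`; the summand of the centre twist `z ∈ (ℤ/2)³` is the SEAM SECTOR `TT.sectorWeight β n z F`
(defs module `QuantileBitPuritySectorDefs`).  We prove, directly on the slice space and WITHOUT spectral input:

* §1 the sector weight as ONE integral on `(seam field) × (slices)`; non-negativity, monotonicity and additivity in the functional `F`;
* §2 ★ `ringInsTrace_zero_eq_sum_sectorWeight`: `ringInsTrace L β n O 0 = (1/8) Σ_z sectorWeight β n z (O(U₀)²)` (one Fubini), hence
  `physTraceSucc L β n = (1/8) Σ_z sectorWeight β n z 1` and the indicator form; every single sector is dominated by the ring weight: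
  `(1/8) sectorWeight β n z 𝟙_B(U₀) ≤ ringInsTrace L β n 𝟙_B 0`;
* §3 ★ THE PERIODIC-SECTOR DOOR.  `ringInsTrace 𝟙_A 0 ≤ Z_phys(n+1) − (1/8)·sectorWeight β n 0 𝟙_{Aᶜ}(U₀)` (exact bookkeeping: the seven twisted
  sectors are bounded by their TOTAL weights, which sum to `8 Z − W_{+++}`), and therefore: IF the periodic sector dominates the zero-flux trace,
  `Z_phys(n+1) ≤ sectorWeight β n 0 1` (the Tomboulis–Yaffe ∕ Kanazawa twist inequality, companion module), and IF inside the periodic sector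
  `sectorWeight 0 𝟙_A ≤ q₀ · sectorWeight 0 1` for some `q₀ ≤ 1`, THEN `ringInsTrace 𝟙_A 0 ≤ (1 − (1 − q₀)/8) · Z_phys(n+1)` — ANY periodic-sector
  estimate with `q₀ < 1` gives the crux's `q < 1`, whatever the twisted sectors do (`ringInsTrace_indicator_le_of_periodic`).

Why this matters (memo §2): on the good-field event the twisted sectors `z ≠ 0` are pinned (twisted holonomies at the equator, untwisted ones at the
centre), so some of them sit INSIDE the core ∕ strip events of the `β^{-a}`-cruxes ⟨23956⟩/⟨23957⟩/⟨23949⟩ — those need an electric-flux suppression input —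
whereas the `q < 1` crux ⟨23948⟩ only needs the periodic sector, by this door.

HONEST FRAMING: fixed-lattice bookkeeping (a reduction); no semiclassics/RG; nothing about infinite volume, the continuum limit or the Clay gap.
No `sorry`, no new axiom, no new definition.  References: [cite: tHooft1979]; [cite: Luscher1983, §2]; [cite: MontvayMunster1994, (3.145)].
-/

set_option autoImplicit false

noncomputable section

open MeasureTheory Filter Topology Real Function
open scoped BigOperators
open Literature.MathematicalPhysics.QuantumLattice
open Literature.MathematicalPhysics.QuantumFieldTheory hiding SU2
open Summit.QuantumFields.YangMills.Theorems

namespace Summit.QuantumFields.YangMills.Theorems.FemtoTransferGap.TT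

open Summit.QuantumFields.YangMills.Theorems.FemtoTransferGap
open Summit.QuantumFields.YangMills.Theorems.FemtoTransferGap.TwoLattice.TowerA

variable {L : ℕ} [NeZero L]

/-! ## §1 The sector integrand: measurability, integrability, one-integral form, positivity, monotonicity, additivity -/

/-- The open chain closed through the twisted seam bond, as a function of (slices, seam field). [folklore] -/
theorem measurable_sectorIntegrand (β : ℝ) (n : ℕ) (z : Fin 3 → Bool)
    {F : (Fin (n + 1) → GaugeConfig 3 L SU2) → (Site 3 L → SU2) → ℝ} (hF : Measurable (uncurry F)) :
    Measurable (uncurry fun (Us : Fin (n + 1) → GaugeConfig 3 L SU2) (g : Site 3 L → SU2) =>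
      (∏ i : Fin n, transferKernel su2Rep β (Us i.castSucc) (Us i.succ)) *
        transferKernel su2Rep β (Us (Fin.last n)) (gaugeTransform g (twist3 z (Us 0))) * F Us g) :=
  (measurable_seamWeight_uncurry (L := L) β z n).mul hF

/-- The seam-closed chain is non-negative. [folklore] -/
theorem seamChain_nonneg (β : ℝ) (n : ℕ) (z : Fin 3 → Bool) (Us : Fin (n + 1) → GaugeConfig 3 L SU2) (g : Site 3 L → SU2) :
    0 ≤ (∏ i : Fin n, transferKernel su2Rep β (Us i.castSucc) (Us i.succ)) *
        transferKernel su2Rep β (Us (Fin.last n)) (gaugeTransform g (twist3 z (Us 0))) :=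
  mul_nonneg (Finset.prod_nonneg fun _ _ => (transferKernel_pos _ _ _ _).le) (transferKernel_pos _ _ _ _).le

/-- Integrability of the sector integrand on `(slices) × (seam field)` for a bounded jointly measurable functional. [folklore] -/
theorem integrable_sectorIntegrand (β : ℝ) (n : ℕ) (z : Fin 3 → Bool)
    {F : (Fin (n + 1) → GaugeConfig 3 L SU2) → (Site 3 L → SU2) → ℝ} (hF : Measurable (uncurry F))
    {C : ℝ} (hFb : ∀ Us g, |F Us g| ≤ C) :
    Integrable (uncurry fun (Us : Fin (n + 1) → GaugeConfig 3 L SU2) (g : Site 3 L → SU2) =>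
      (∏ i : Fin n, transferKernel su2Rep β (Us i.castSucc) (Us i.succ)) *
        transferKernel su2Rep β (Us (Fin.last n)) (gaugeTransform g (twist3 z (Us 0))) * F Us g)
      ((Measure.pi fun _ : Fin (n + 1) => configMeasure SU2 L).prod (gaugeMeasure L)) := by
  haveI := isProbabilityMeasure_gaugeMeasure (L := L)
  obtain ⟨M, hM0, hM⟩ := PhysL2.exists_norm_transferKernel_le (L := L) β
  have hC : 0 ≤ C := (abs_nonneg _).trans (hFb (fun _ _ => 1) fun _ => 1)
  refine Integrable.of_bound (measurable_sectorIntegrand β n z hF).aestronglyMeasurable (M ^ n * M * C) (ae_of_all _ fun p => ?_)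
  rw [uncurry_apply_pair, norm_mul]
  exact mul_le_mul (abs_seamWeight_le hM0 hM p.1 _) (by rw [Real.norm_eq_abs]; exact hFb _ _) (norm_nonneg _) (by positivity)

/-- **One-integral form**: `sectorWeight β n z F = ∫ (chain · seam · F) d(slices ⊗ seam field)`. [folklore] -/
theorem sectorWeight_eq_integral_prod (β : ℝ) (n : ℕ) (z : Fin 3 → Bool)
    {F : (Fin (n + 1) → GaugeConfig 3 L SU2) → (Site 3 L → SU2) → ℝ} (hF : Measurable (uncurry F))
    {C : ℝ} (hFb : ∀ Us g, |F Us g| ≤ C) :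
    sectorWeight β n z F = ∫ p : (Fin (n + 1) → GaugeConfig 3 L SU2) × (Site 3 L → SU2),
      (∏ i : Fin n, transferKernel su2Rep β (p.1 i.castSucc) (p.1 i.succ)) *
        transferKernel su2Rep β (p.1 (Fin.last n)) (gaugeTransform p.2 (twist3 z (p.1 0))) * F p.1 p.2
      ∂((Measure.pi fun _ : Fin (n + 1) => configMeasure SU2 L).prod (gaugeMeasure L)) := by
  haveI := isProbabilityMeasure_gaugeMeasure (L := L)
  have hint := integrable_sectorIntegrand (L := L) β n z hF hFb
  have hint' : Integrable (fun p : (Fin (n + 1) → GaugeConfig 3 L SU2) × (Site 3 L → SU2) =>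
      (∏ i : Fin n, transferKernel su2Rep β (p.1 i.castSucc) (p.1 i.succ)) *
        transferKernel su2Rep β (p.1 (Fin.last n)) (gaugeTransform p.2 (twist3 z (p.1 0))) * F p.1 p.2)
      ((Measure.pi fun _ : Fin (n + 1) => configMeasure SU2 L).prod (gaugeMeasure L)) := hint
  rw [sectorWeight_apply, integral_prod _ hint']
  exact (integral_integral_swap hint).symm

/-- **Non-negativity**: `0 ≤ sectorWeight β n z F` for `F ≥ 0`. [folklore] -/
theorem sectorWeight_nonneg (β : ℝ) (n : ℕ) (z : Fin 3 → Bool)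
    {F : (Fin (n + 1) → GaugeConfig 3 L SU2) → (Site 3 L → SU2) → ℝ} (hF0 : ∀ Us g, 0 ≤ F Us g) :
    0 ≤ sectorWeight β n z F := by
  rw [sectorWeight_apply]
  exact integral_nonneg fun g => integral_nonneg fun Us => mul_nonneg (seamChain_nonneg β n z Us g) (hF0 Us g)

/-- **Monotonicity** in the functional: `F ≤ G ⇒ sectorWeight F ≤ sectorWeight G` (bounded measurable `F`, `G`). [folklore] -/
theorem sectorWeight_mono (β : ℝ) (n : ℕ) (z : Fin 3 → Bool)
    {F G : (Fin (n + 1) → GaugeConfig 3 L SU2) → (Site 3 L → SU2) → ℝ} (hF : Measurable (uncurry F)) (hG : Measurable (uncurry G))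
    {C : ℝ} (hFb : ∀ Us g, |F Us g| ≤ C) (hGb : ∀ Us g, |G Us g| ≤ C) (hFG : ∀ Us g, F Us g ≤ G Us g) :
    sectorWeight β n z F ≤ sectorWeight β n z G := by
  haveI := isProbabilityMeasure_gaugeMeasure (L := L)
  rw [sectorWeight_eq_integral_prod β n z hF hFb, sectorWeight_eq_integral_prod β n z hG hGb]
  refine integral_mono (integrable_sectorIntegrand β n z hF hFb) (integrable_sectorIntegrand β n z hG hGb) fun p => ?_
  exact mul_le_mul_of_nonneg_left (hFG _ _) (seamChain_nonneg β n z _ _)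

/-- **Additivity** in the functional: `sectorWeight (F + G) = sectorWeight F + sectorWeight G` (bounded measurable `F`, `G`). [folklore] -/
theorem sectorWeight_add (β : ℝ) (n : ℕ) (z : Fin 3 → Bool)
    {F G : (Fin (n + 1) → GaugeConfig 3 L SU2) → (Site 3 L → SU2) → ℝ} (hF : Measurable (uncurry F)) (hG : Measurable (uncurry G))
    {C : ℝ} (hFb : ∀ Us g, |F Us g| ≤ C) (hGb : ∀ Us g, |G Us g| ≤ C) :
    sectorWeight β n z (fun Us g => F Us g + G Us g) = sectorWeight β n z F + sectorWeight β n z G := by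
  haveI := isProbabilityMeasure_gaugeMeasure (L := L)
  have hFG : Measurable (uncurry fun Us g => F Us g + G Us g) := hF.add hG
  have hFGb : ∀ Us g, |F Us g + G Us g| ≤ C + C := fun Us g => (abs_add_le _ _).trans (add_le_add (hFb Us g) (hGb Us g))
  have hintF : Integrable (fun p : (Fin (n + 1) → GaugeConfig 3 L SU2) × (Site 3 L → SU2) =>
      (∏ i : Fin n, transferKernel su2Rep β (p.1 i.castSucc) (p.1 i.succ)) *
        transferKernel su2Rep β (p.1 (Fin.last n)) (gaugeTransform p.2 (twist3 z (p.1 0))) * F p.1 p.2)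
      ((Measure.pi fun _ : Fin (n + 1) => configMeasure SU2 L).prod (gaugeMeasure L)) := integrable_sectorIntegrand (L := L) β n z hF hFb
  have hintG : Integrable (fun p : (Fin (n + 1) → GaugeConfig 3 L SU2) × (Site 3 L → SU2) =>
      (∏ i : Fin n, transferKernel su2Rep β (p.1 i.castSucc) (p.1 i.succ)) *
        transferKernel su2Rep β (p.1 (Fin.last n)) (gaugeTransform p.2 (twist3 z (p.1 0))) * G p.1 p.2)
      ((Measure.pi fun _ : Fin (n + 1) => configMeasure SU2 L).prod (gaugeMeasure L)) := integrable_sectorIntegrand (L := L) β n z hG hGb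
  rw [sectorWeight_eq_integral_prod β n z hFG hFGb, sectorWeight_eq_integral_prod β n z hF hFb, sectorWeight_eq_integral_prod β n z hG hGb,
    ← integral_add hintF hintG]
  refine integral_congr_ae (ae_of_all _ fun p => ?_)
  simp only [mul_add]

/-! ## §2 The sector decomposition of the ring trace -/

omit [NeZero L] in
/-- Joint measurability of a slice-`0` observable read as a functional of (slices, seam field). [folklore] -/
theorem measurable_uncurry_slice_zero {n : ℕ} {f : GaugeConfig 3 L SU2 → ℝ} (hf : Measurable f) :
    Measurable (uncurry fun (Us : Fin (n + 1) → GaugeConfig 3 L SU2) (_g : Site 3 L → SU2) => f (Us 0)) := by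
  have h1 : Measurable fun p : (Fin (n + 1) → GaugeConfig 3 L SU2) × (Site 3 L → SU2) => p.1 0 :=
    (measurable_pi_apply (0 : Fin (n + 1))).comp measurable_fst
  exact hf.comp h1

/-- ★ **Sector decomposition of the ring trace** (one Fubini on `physAvg`):
`ringInsTrace L β n O 0 = (1/8) Σ_{z ∈ (ℤ/2)³} sectorWeight β n z (O(U₀)·O(U₀))` for a bounded measurable slice observable `O`.
[cite: MontvayMunster1994, (3.145)] [cite: tHooft1979] -/
theorem ringInsTrace_zero_eq_sum_sectorWeight (β : ℝ) (n : ℕ) {O : GaugeConfig 3 L SU2 → ℝ} (hO : Measurable O)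
    {C : ℝ} (hOb : ∀ U, |O U| ≤ C) :
    ringInsTrace L β n O 0 = (1 / 8 : ℝ) * ∑ z : Fin 3 → Bool, sectorWeight β n z fun Us _ => O (Us 0) * O (Us 0) := by
  haveI := isProbabilityMeasure_gaugeMeasure (L := L)
  have hC : 0 ≤ C := (abs_nonneg _).trans (hOb fun _ => 1)
  have hO2 : Measurable (uncurry fun (Us : Fin (n + 1) → GaugeConfig 3 L SU2) (_g : Site 3 L → SU2) => O (Us 0) * O (Us 0)) :=
    measurable_uncurry_slice_zero (n := n) (hO.mul hO)
  have hO2b : ∀ (Us : Fin (n + 1) → GaugeConfig 3 L SU2) (_g : Site 3 L → SU2), |O (Us 0) * O (Us 0)| ≤ C * C := fun Us _ => by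
    rw [abs_mul]; exact mul_le_mul (hOb _) (hOb _) (abs_nonneg _) hC
  -- pointwise: pull the product and the observable inside the average
  have hpt : ∀ Us : Fin (n + 1) → GaugeConfig 3 L SU2,
      (∏ i : Fin n, transferKernel su2Rep β (Us i.castSucc) (Us i.succ)) *
          physAvg (transferKernel su2Rep β (Us (Fin.last n))) (Us 0) * (O (Us 0) * O (Us 0)) =
        (1 / 8 : ℝ) * ∑ z : Fin 3 → Bool, ∫ g,
          (∏ i : Fin n, transferKernel su2Rep β (Us i.castSucc) (Us i.succ)) *
            transferKernel su2Rep β (Us (Fin.last n)) (gaugeTransform g (twist3 z (Us 0))) * (O (Us 0) * O (Us 0)) ∂gaugeMeasure L := by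
    intro Us
    calc (∏ i : Fin n, transferKernel su2Rep β (Us i.castSucc) (Us i.succ)) *
          physAvg (transferKernel su2Rep β (Us (Fin.last n))) (Us 0) * (O (Us 0) * O (Us 0))
        = (1 / 8 : ℝ) * ((∏ i : Fin n, transferKernel su2Rep β (Us i.castSucc) (Us i.succ)) *
            (∑ z : Fin 3 → Bool, ∫ g, transferKernel su2Rep β (Us (Fin.last n)) (gaugeTransform g (twist3 z (Us 0))) ∂gaugeMeasure L) *
            (O (Us 0) * O (Us 0))) := by unfold physAvg; ring
      _ = (1 / 8 : ℝ) * ∑ z : Fin 3 → Bool, (∏ i : Fin n, transferKernel su2Rep β (Us i.castSucc) (Us i.succ)) *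
            (∫ g, transferKernel su2Rep β (Us (Fin.last n)) (gaugeTransform g (twist3 z (Us 0))) ∂gaugeMeasure L) *
            (O (Us 0) * O (Us 0)) := by rw [Finset.mul_sum, Finset.sum_mul]
      _ = _ := by
        congr 1
        refine Finset.sum_congr rfl fun z _ => ?_
        rw [← integral_const_mul, ← integral_mul_const]
  have hint : ∀ z : Fin 3 → Bool, Integrable (uncurry fun (Us : Fin (n + 1) → GaugeConfig 3 L SU2) (g : Site 3 L → SU2) =>
      (∏ i : Fin n, transferKernel su2Rep β (Us i.castSucc) (Us i.succ)) *
        transferKernel su2Rep β (Us (Fin.last n)) (gaugeTransform g (twist3 z (Us 0))) * (O (Us 0) * O (Us 0)))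
      ((Measure.pi fun _ : Fin (n + 1) => configMeasure SU2 L).prod (gaugeMeasure L)) :=
    fun z => integrable_sectorIntegrand (L := L) β n z hO2 hO2b
  have hint' : ∀ z : Fin 3 → Bool, Integrable (fun Us : Fin (n + 1) → GaugeConfig 3 L SU2 => ∫ g,
      (∏ i : Fin n, transferKernel su2Rep β (Us i.castSucc) (Us i.succ)) *
        transferKernel su2Rep β (Us (Fin.last n)) (gaugeTransform g (twist3 z (Us 0))) * (O (Us 0) * O (Us 0)) ∂gaugeMeasure L)
      (Measure.pi fun _ : Fin (n + 1) => configMeasure SU2 L) := fun z => (hint z).integral_prod_left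
  rw [ringInsTrace_zero_eq]
  simp_rw [hpt]
  rw [integral_const_mul, integral_finsetSum _ fun z _ => hint' z]
  congr 1
  refine Finset.sum_congr rfl fun z _ => ?_
  rw [sectorWeight_apply]
  exact integral_integral_swap (hint z)

/-- **The zero-flux trace decomposed**: `physTraceSucc L β n = (1/8) Σ_z sectorWeight β n z 1`. [cite: MontvayMunster1994, (3.145)] -/
theorem physTraceSucc_eq_sum_sectorWeight (β : ℝ) (n : ℕ) :
    physTraceSucc L β n = (1 / 8 : ℝ) * ∑ z : Fin 3 → Bool, sectorWeight (L := L) β n z fun _ _ => (1 : ℝ) := by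
  rw [physTraceSucc_eq_sum_integral_seam (L := L)]
  congr 1
  refine Finset.sum_congr rfl fun z _ => ?_
  rw [sectorWeight_apply]
  simp only [mul_one]

/-- **Indicator form**: `ringInsTrace L β n 𝟙_A 0 = (1/8) Σ_z sectorWeight β n z 𝟙_A(U₀)`. [cite: MontvayMunster1994, (3.145)] -/
theorem ringInsTrace_indicator_zero_eq_sum_sectorWeight (β : ℝ) (n : ℕ) {A : Set (GaugeConfig 3 L SU2)} (hA : MeasurableSet A) :
    ringInsTrace L β n (A.indicator fun _ => (1 : ℝ)) 0 =
      (1 / 8 : ℝ) * ∑ z : Fin 3 → Bool, sectorWeight β n z fun Us _ => A.indicator (fun _ => (1 : ℝ)) (Us 0) := by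
  rw [ringInsTrace_zero_eq_sum_sectorWeight β n (measurable_const.indicator hA) (abs_indicator_one_le A)]
  congr 1
  refine Finset.sum_congr rfl fun z _ => congrArg _ (funext fun Us => funext fun g => ?_)
  by_cases hU : Us 0 ∈ A
  · rw [Set.indicator_of_mem hU, mul_one]
  · rw [Set.indicator_of_notMem hU, mul_zero]

/-- **Every single sector is dominated by the ring weight**: `(1/8)·sectorWeight β n z 𝟙_B(U₀) ≤ ringInsTrace L β n 𝟙_B 0` (the other seven
sectors are non-negative). [folklore] -/
theorem sectorWeight_indicator_le_ringInsTrace (β : ℝ) (n : ℕ) (z : Fin 3 → Bool) {B : Set (GaugeConfig 3 L SU2)} (hB : MeasurableSet B) :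
    (1 / 8 : ℝ) * sectorWeight β n z (fun Us _ => B.indicator (fun _ => (1 : ℝ)) (Us 0)) ≤
      ringInsTrace L β n (B.indicator fun _ => (1 : ℝ)) 0 := by
  rw [ringInsTrace_indicator_zero_eq_sum_sectorWeight β n hB]
  refine mul_le_mul_of_nonneg_left ?_ (by norm_num)
  exact Finset.single_le_sum (f := fun w : Fin 3 → Bool => sectorWeight (L := L) β n w fun Us _ => B.indicator (fun _ => (1 : ℝ)) (Us 0))
    (fun w _ => sectorWeight_nonneg β n w fun Us _ => Set.indicator_nonneg (fun _ _ => zero_le_one) _) (Finset.mem_univ z)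

/-! ## §3 The periodic-sector door -/

/-- Complement additivity inside one sector: `sectorWeight z 𝟙_A(U₀) + sectorWeight z 𝟙_{Aᶜ}(U₀) = sectorWeight z 1`. [folklore] -/
theorem sectorWeight_indicator_add_compl (β : ℝ) (n : ℕ) (z : Fin 3 → Bool) {A : Set (GaugeConfig 3 L SU2)} (hA : MeasurableSet A) :
    sectorWeight β n z (fun Us _ => A.indicator (fun _ => (1 : ℝ)) (Us 0)) +
        sectorWeight β n z (fun Us _ => Aᶜ.indicator (fun _ => (1 : ℝ)) (Us 0)) =
      sectorWeight (L := L) β n z fun _ _ => (1 : ℝ) := by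
  rw [← sectorWeight_add β n z (measurable_uncurry_slice_zero (measurable_const.indicator hA))
    (measurable_uncurry_slice_zero (measurable_const.indicator hA.compl)) (fun Us _ => abs_indicator_one_le A (Us 0))
    (fun Us _ => abs_indicator_one_le Aᶜ (Us 0))]
  congr 1
  funext Us g
  exact Set.indicator_self_add_compl_apply A (fun _ => (1 : ℝ)) (Us 0)

/-- ★ **Door inequality (exact sector bookkeeping)**: `ringInsTrace L β n 𝟙_A 0 ≤ Z_phys(n+1) − (1/8)·sectorWeight β n 0 𝟙_{Aᶜ}(U₀)` —
the weight of `A` is at most the zero-flux trace minus the PERIODIC sector's weight of the complement (the seven twisted sectors of `Aᶜ` are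
simply dropped).  `β ≥ 0`. [cite: tHooft1979] [cite: MontvayMunster1994, (3.145)] -/
theorem ringInsTrace_indicator_le_physTraceSucc_sub_sector {β : ℝ} (hβ : 0 ≤ β) (n : ℕ) {A : Set (GaugeConfig 3 L SU2)} (hA : MeasurableSet A) :
    ringInsTrace L β n (A.indicator fun _ => (1 : ℝ)) 0 ≤
      physTraceSucc L β n - (1 / 8 : ℝ) * sectorWeight β n (fun _ => false) (fun Us _ => Aᶜ.indicator (fun _ => (1 : ℝ)) (Us 0)) := by
  have h1 := ringInsTrace_indicator_zero_add_compl (L := L) hβ n hA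
  have h2 := sectorWeight_indicator_le_ringInsTrace (L := L) β n (fun _ => false) hA.compl
  linarith

/-- ★ **THE PERIODIC-SECTOR DOOR.**  If the periodic sector dominates the zero-flux trace (`Z_phys(n+1) ≤ sectorWeight β n 0 1` — the
Tomboulis–Yaffe ∕ Kanazawa twist inequality, companion module) and, INSIDE the periodic sector, the event `A` carries at most the fraction
`q₀ ≤ 1` of the weight, then `ringInsTrace L β n 𝟙_A 0 ≤ (1 − (1 − q₀)/8) · Z_phys(n+1)`: any `q₀ < 1` gives a thermal fraction `< 1`,
whatever the seven twisted sectors do. [cite: tHooft1979] [cite: MontvayMunster1994, (3.145)] -/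
theorem ringInsTrace_indicator_le_of_periodic {β : ℝ} (hβ : 0 ≤ β) (n : ℕ) {A : Set (GaugeConfig 3 L SU2)} (hA : MeasurableSet A)
    {q₀ : ℝ} (hq₀ : q₀ ≤ 1)
    (hZ : physTraceSucc L β n ≤ sectorWeight (L := L) β n (fun _ => false) fun _ _ => (1 : ℝ))
    (hq : sectorWeight β n (fun _ => false) (fun Us _ => A.indicator (fun _ => (1 : ℝ)) (Us 0)) ≤
      q₀ * sectorWeight (L := L) β n (fun _ => false) fun _ _ => (1 : ℝ)) :
    ringInsTrace L β n (A.indicator fun _ => (1 : ℝ)) 0 ≤ (1 - (1 - q₀) / 8) * physTraceSucc L β n := by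
  have h1 := ringInsTrace_indicator_le_physTraceSucc_sub_sector (L := L) hβ n hA
  have h2 := sectorWeight_indicator_add_compl (L := L) β n (fun _ => false) hA
  -- the complement carries at least the fraction `1 − q₀` of the periodic sector, hence of `Z`
  have h3 : (1 - q₀) * physTraceSucc L β n ≤
      sectorWeight β n (fun _ => false) (fun Us _ => Aᶜ.indicator (fun _ => (1 : ℝ)) (Us 0)) := by
    have h4 : (1 - q₀) * physTraceSucc L β n ≤ (1 - q₀) * sectorWeight (L := L) β n (fun _ => false) (fun _ _ => (1 : ℝ)) :=
      mul_le_mul_of_nonneg_left hZ (by linarith)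
    linarith
  linarith

end Summit.QuantumFields.YangMills.Theorems.FemtoTransferGap.TT

end
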